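import Summits.BirchSwinnertonDyer.Rank1Residual.Additive.X3BranchAnalyticHalfGord
import Summits.BirchSwinnertonDyer.Rank1Residual.Additive.X3BranchLowerEndStateThm16
import Summits.BirchSwinnertonDyer.Rank1Residual.Additive.GordIsogenyInvariance
import Summits.BirchSwinnertonDyer.Rank1Residual.Additive.GordRankZeroChiBranch
import Summits.BirchSwinnertonDyer.Rank1Residual.Additive.TypeGThree
import HarnessLib

/-!
# X3♯(G-ord) ∩ `I₀*` (additive (G)-ordinary prime, defect `2`, `E[p]` reducible), rank `0`: the END
# STATE from PRINT + ONE displayed algebraic count — `Typed.MissingLowerBoundAt E p` and `BSD(E,p)`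
# at every `p ≥ 5` off the CM / anomalous rows, and at `p = 3` off the degenerate rows
# (cell `bsd-addord`, seat `bsd-addord-twist`; sequel of `X3BranchAnalyticHalfGord.lean`)

HONEST FRAMING (cell `bsd-addord`, `run/shared/lean/pub/bsd-addord/README.md` §4): the programme's
target of record is the full Birch–Swinnerton-Dyer formula for every `E/ℚ` of analytic rank `≤ 1`;
this file concerns the X3 rows of cell (G-ord, `e = 2`) of N10 only and books NOTHING: X3 stays
CONSTRUCTION-SHAPED. THEOREMS ONLY (no `def`, no named fact, no `sorry`). Every PUBLISHED input is an
explicit named-fact binder passed verbatim to team n1011's end-state consumers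
(`X3BranchLowerEndState[Thm16].lean`): `hW16` Wuthrich 2014 Thm. 16 (half-eigen reading); `hGV`
Greenberg–Vatsal 2000 Thm. (3.12) on the `ω^{(p−1)/2}`-branch at a good ordinary prime (reading-fact
p396718, cell `bsd-eis` seat x3; its `p ≡ 1 (mod 4)` case = this seat's p396680); `hPal` Pal 2012
Thm. 3.2; `hDel` / `hDel3` Delbourgo 2002 Theorems (A), (B) (`p ≥ 5` / `p = 3` forms); `hDel98`
Delbourgo 1998 Prop. 4; `hGZK`; `hmod` / `hmodD` modularity. The ONE unprinted input is the
DISPLAYED hypothesis `hAlg` of the sibling file — Greenberg–Vatsal's ALGEBRAIC residual count on the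
branch for every twist model (seat memo App. A; cell `bsd-eis` x3-MEMO-2; not in print, never
asserted here).

## What and why

The sibling proves, at the level of ONE good-ordinary twist model `V` (`C • V^{(p*)} = W`):
`hW16 ∧ hGV ∧ hAlg ⟹ X3Branch.X3BranchMainConjectureAt V p`. Team n1011's consumers take the branch
main conjecture for EVERY twist model. This file supplies the glue and reads off the end state:

* §1 `TypeGOrd.goodOrd_of_pStar_twist_model` — on an additive (G)-ordinary pair of defect `2`
  EVERY globally minimal twist model `V` with `C • V^{(p*)} = W` is good ordinary at `p` (two such
  models are `ℚ`-isomorphic, hence isogenous; good reduction and `a_p` are isogeny invariants —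
  Silverman *AEC* Cor. VII.7.2, Faltings; tree `TypeGOrd.exists_goodOrd_pStar_twist_model`,
  `hasGoodReductionAtPrime_iff_of_isIsogenous`, `frobeniusTrace_eq_of_isIsogenous`);
  `ClassX3Gord.forall_x3BranchMainConjecture_of_thm312_of_algebraicCount` — the branch main
  conjecture for every twist model, from `hW16 ∧ hGV ∧ hAlg` (the latter for every twist model).
* §2 `p ≥ 5`, `r_an = 0`, non-CM, non-anomalous:
  `ClassX3Gord.missingLowerBoundAt_rankZero_of_thm312_of_algebraicCount_of_nonAnomalous`
  (`Typed.MissingLowerBoundAt W p`, the N10 decl of record) and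
  `ClassX3Gord.bsdp_rankZero_of_thm312_of_algebraicCount_of_nonAnomalous` (`BSDp W p`; upper half =
  the Wuthrich component chain, no image / Tamagawa / Manin / `#Ш_an` hypothesis); at every odd `p`
  the cyclotomic `T = 0` input `ClassX3Gord.cycLowerLeadingTermAt_of_thm312_of_algebraicCount`;
  and the bare-`λ` variant of the sibling's composition over x3's `X3BranchAlgebraicLambdaAt`.
* `p = 3` (twist by `−3`, defect `2` automatic, degenerate rows excluded) is the sibling
  `X3BranchAnalyticHalfGordThree.lean`.

KERNEL SENTENCE (wording for the cell's TARGET ledger, no mark moved): on X3♯(G-ord) ∩ `I₀*` ∧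
`r_an = 0` ∧ branch-parity (the even line of `E[p]` is the one whose `χ_{p*}`-twist is ramified),
off CM / anomalous (`p ≥ 5`) resp. degenerate (`p = 3`) rows, `BSD(E,p)` ⟸ PUBLISHED facts
(Wuthrich Thm. 16, GV Thm. (3.12), Pal, Delbourgo 1998/2002, GZK, modularity) ∧ ONE OPEN statement:
Greenberg–Vatsal's algebraic `λ`-count on the `ω^{(p−1)/2}`-branch (`hAlg`). The ANALYTIC half of
T-X3-χ is no longer an input. Reach (seat memo App. C, `N < 5·10⁵`, `p ≡ 1 (mod 4)` share only):
(G-ord, `e = 2`) X3 classes at `p ≥ 5` with `GVPar(E♭)`: 209 of 464 (10 content classes overall on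
(G-ord) ∪ (M)); the `p ≡ 3 (mod 4)` share is x3's census (`N ≤ 3000`: 10 parity-OK non-degenerate
+ 121 degenerate + 24 parity-BAD at `p = 3`; 1/1 at `p = 7`).

## What this is NOT

Not a class theorem and not a booking (`hAlg` OPEN); not the (M) cell (separate open binder,
`X3BranchMultCongruence.lean`); not rank `1` (the same branch main conjecture is the Iwasawa input
of the O7-ord rows — seat `bsd-addord-gz`); not `e ∈ {3,4,6}`; not the parity-BAD rows.

References: [GreenbergVatsal2000] Thm. (1.3), p. 4, §2 (16), §3 Thm. (3.12), Cor. (3.8);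
[Wuthrich2014] Thm. 16; [Delbourgo2002] Theorems (A), (B) (p. 40); [Delbourgo1998] Prop. 4 (p. 144);
[Pal2012] Thm. 3.2; [SilvermanAEC2009] Cor. VII.7.2; [MazurTateTeitelbaum1986Invent] §I.13–I.14.
-/

set_option autoImplicit false

noncomputable section

open scoped Classical MatrixGroups ModularForm

namespace Summit.BirchSwinnertonDyer.Rank1Residual.Additive

open CongruenceSubgroup WeierstrassCurve NumberField IsDedekindDomain Field
  Literature.NumberTheory.EllipticCurves
  Literature.NumberTheory.EllipticCurves.ModularForms
  Literature.NumberTheory.EllipticCurves.GreenbergVatsal2000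
  Literature.NumberTheory.EllipticCurves.Rank1Residual
  Literature.NumberTheory.EllipticCurves.Rank1Residual.Typed
  Literature.NumberTheory.GaloisRepresentations
  Summit.BirchSwinnertonDyer.Rank1Residual.X1.MuLambda
  Summit.BirchSwinnertonDyer.Rank1Residual.AdditivePotMult
  Summit.BirchSwinnertonDyer.Rank1Residual.Additive.X3Branch

/-! ### §1 Class level: every twist model is good ordinary; the branch main conjecture for every twist model -/

section ClassLevel

variable {W : WeierstrassCurve ℚ} [W.IsElliptic] [W.IsGloballyMinimal] {p : ℕ} [hp : Fact p.Prime]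

/-- **Every twist model of an additive (G)-ordinary pair of defect `2` is good ordinary.** For `E`
additive at the odd prime `p` with `TypeGOrd W p` and `semistabilityIndex W p = 2`, EVERY globally
minimal `V` with `C • V^{(p*)} = W` is good ordinary at `p`: the tree's
`TypeGOrd.exists_goodOrd_pStar_twist_model` gives ONE such `V₀`; `V` and `V₀` are both `ℚ`-models of
`W^{(p*)}` (`exists_variableChange_twist_of_model_twist`), hence `ℚ`-isomorphic, hence isogenous
(`isIsogenous_smul`), and good reduction at `p` and `a_p` are `ℚ`-isogeny invariants (Silverman
*AEC* Cor. VII.7.2; `a_p` by Faltings / *AEC* Ex. 5.4; tree `hasGoodReductionAtPrime_iff_of_isIsogenous`,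
`frobeniusTrace_eq_of_isIsogenous`). [cite: SilvermanAEC2009, Cor. VII.7.2] -/
theorem TypeGOrd.goodOrd_of_pStar_twist_model (hp2 : p ≠ 2) (hG : TypeGOrd W p) (hadd : Addv W p)
    (he : semistabilityIndex W p = 2) {V : WeierstrassCurve ℚ} [V.IsElliptic] [V.IsGloballyMinimal]
    (hV : ∃ C : VariableChange ℚ, C • V.quadraticTwist ((-1) ^ (p / 2) * p : ℚ) = W) :
    GoodOrd V p := by
  have hpS : ((-1 : ℚ) ^ (p / 2) * p) ≠ 0 := pStar_ne_zero p
  obtain ⟨V₀, _, _, C₀, hord₀, hC₀⟩ := TypeGOrd.exists_goodOrd_pStar_twist_model W p hp2 hG hadd he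
  obtain ⟨C, hC⟩ := hV
  obtain ⟨C', hC'⟩ := exists_variableChange_twist_of_model_twist V hpS hC
  obtain ⟨C₀', hC₀'⟩ := exists_variableChange_twist_of_model_twist V₀ hpS hC₀
  have hVV₀ : (C' * C₀'⁻¹) • V₀ = V := by
    rw [mul_smul, ← hC₀', inv_smul_smul, hC']
  have hiso : IsIsogenous V₀ V := hVV₀ ▸ isIsogenous_smul V₀ (C' * C₀'⁻¹)
  have hgood : V.HasGoodReductionAtPrime p :=
    (hasGoodReductionAtPrime_iff_of_isIsogenous hiso p).mp hord₀.1
  exact ⟨hgood, by rw [← frobeniusTrace_eq_of_isIsogenous hiso p hord₀.1 hgood]; exact hord₀.2⟩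

/-- **X3♯(G-ord) ∩ `I₀*` (odd `p`): the `ω^{(p−1)/2}`-branch main conjecture of EVERY twist model
from Wuthrich Thm. 16 (`hW16`) ∧ GV Thm. (3.12) on the branch (`hGV`) ∧ the DISPLAYED algebraic
residual count `hAlg` for every twist model** — the sibling's
`X3Branch.mainConjectureAt_of_thm312_of_algebraicCount` at each twist model (good ordinary by
`TypeGOrd.goodOrd_of_pStar_twist_model`). Data on the additive `W`: `Σ₀ ∌ p` finite with every bad
place `≠ p` inside; `Φ₀ ≤ W[p]` a rational line, EVEN, with non-trivial `Γ_ℚ`-action, whose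
`χ_{p*}`-twist is ramified at `p` (the branch parity condition `BranchGVParAt` read on `W`). This is
exactly the `hMC` binder of team n1011's end-state consumers. NOT a class theorem (`hAlg` OPEN).
[cite: GreenbergVatsal2000, p. 4, §2 (16) p. 29, §3 Thm. (3.12) p. 45] [cite: Wuthrich2014, Thm. 16 (p. 397)] -/
theorem ClassX3Gord.forall_x3BranchMainConjecture_of_thm312_of_algebraicCount
    (hW16 : Wuthrich2014.thm16_halfEigenCharIdeal_dvd_cyclotomicPrime)
    (hGV : thm312_branch_unitContent_and_lambda_eq_residual_goodOrd)
    (hX : ClassX3Gord W p) (hp2 : p ≠ 2) (he : semistabilityIndex W p = 2)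
    (S₀ : Finset (HeightOneSpectrum (𝓞 ℚ))) (hS₀ : ∀ v ∈ S₀, ((p : ℕ) : 𝓞 ℚ) ∉ v.asIdeal)
    (hS : ∀ v : HeightOneSpectrum (𝓞 ℚ), v ∉ S₀ → ((p : ℕ) : 𝓞 ℚ) ∉ v.asIdeal →
      W.HasGoodReductionAt v)
    (Φ₀ : AddSubgroup (W.geomTorsion (p : ℤ))) (hΦ : IsRationalLine W p Φ₀)
    (heven : LineEven W p Φ₀)
    (hnt : ∃ (σ : absoluteGaloisGroup ℚ) (P : W.geomTorsion (p : ℤ)), P ∈ Φ₀ ∧ σ • P ≠ P)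
    (hram : ∀ (K : Type) [Field K] [NumberField K] [(galRange (K := ℚ) K).Normal],
      Module.finrank ℚ K = 2 → (∃ θ : K, θ ^ 2 = algebraMap ℚ K ((-1) ^ (p / 2) * p)) →
      ¬ ∀ v : HeightOneSpectrum (𝓞 ℚ), ((p : ℕ) : 𝓞 ℚ) ∈ v.asIdeal →
        ∀ 𝔓 ∈ v.primesAbove, ∀ σ ∈ 𝔓.inertia (absoluteGaloisGroup ℚ), ∀ P ∈ Φ₀,
          σ • P = (if σ ∈ galRange (K := ℚ) K then P else -P))
    (hAlg : ∀ (V : WeierstrassCurve ℚ) [V.IsElliptic] [V.IsGloballyMinimal],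
      (∃ C : VariableChange ℚ, C • V.quadraticTwist ((-1) ^ (p / 2) * p : ℚ) = W) →
      ∀ (K : Type) [Field K] [NumberField K] [(galRange (K := ℚ) K).Normal]
      (F : Type) [Field F] [NumberField F] [IsCyclotomicExtension {p} ℚ F]
      [(galRange (K := ℚ) F).Normal]
      {κ : ZpExtension ℚ p} {γ : Field.absoluteGaloisGroup ℚ},
      p ≠ 2 → Module.finrank ℚ K = 2 →
      (∃ θ : K, θ ^ 2 = algebraMap ℚ K ((-1) ^ (p / 2) * p)) →
      ¬ V.HasIrreducibleModPGaloisRep p →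
      κ.IsCyclotomic → κ.IsTopGenerator γ → IsCyclotomicVariable p γ →
      γ ∈ galRange (K := ℚ) K → γ ∈ galRange (K := ℚ) F →
      ∀ (D : V.EigenSelmerDualData p
          (κ.kerSubgroup ⊓ galRange (K := ℚ) K ⊓ galRange (K := ℚ) F) κ.kerSubgroup
          (fun g ↦ if g ∈ galRange (K := ℚ) K then 1 else -1) γ)
        (g : IwasawaAlgebra p), D.charIdeal = Ideal.span {g} → HasUnitContent g →
          p ^ (lam g + ∑ v ∈ S₀, delta W p v) =
            Nat.card (residualLineH1 W p κ S₀ Φ₀ hΦ) * Nat.card (residualQuotSelmer W p κ S₀ Φ₀ hΦ)) :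
    ∀ (V : WeierstrassCurve ℚ) [V.IsElliptic] [V.IsGloballyMinimal],
      (∃ C : VariableChange ℚ, C • V.quadraticTwist ((-1) ^ (p / 2) * p : ℚ) = W) →
        X3BranchMainConjectureAt V p :=
  fun V _ _ hVW ↦
    X3Branch.mainConjectureAt_of_thm312_of_algebraicCount hW16 hGV
      (TypeGOrd.goodOrd_of_pStar_twist_model hp2 hX.typeGOrd hX.addv he hVW) hVW S₀ hS₀ hS Φ₀ hΦ heven
      hnt hram (hAlg V hVW)

end ClassLevel

/-! ### §2 END STATE on X3♯(G-ord) ∩ `I₀*`, `p ≥ 5` (and the cyclotomic `T = 0` input at every odd `p`) -/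

section EndState

variable {W : WeierstrassCurve ℚ} [W.IsElliptic] [W.IsGloballyMinimal] {p : ℕ} [hp : Fact p.Prime]

/-- **X3♯(G-ord) ∩ `I₀*`, `p` odd: the cyclotomic `T = 0` LOWER input `CycLowerLeadingTermAt W p`**
("for every generator `f` of `char_Λ X(E/ℚ_∞)`, `L(E,1)/Ω_E ∣ f(0)`") from `hW16 ∧ hGV ∧ hAlg` and
the PUBLISHED transport (Birch + Pal 2012 Thm. 3.2 on the even branch, `hPal`; modularity `hmod`,
`hmodD`) — §1 into team n1011's `ClassX3Gord.cycLowerLeadingTermAt_of_forall_x3BranchMainConjecture`.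
Rank-free. [cite: Pal2012, Thm. 3.2] [cite: MazurTateTeitelbaum1986Invent, §I.13–I.14]
[cite: GreenbergVatsal2000, §3 Thm. (3.12) p. 45] [cite: Wuthrich2014, Thm. 16 (p. 397)] -/
theorem ClassX3Gord.cycLowerLeadingTermAt_of_thm312_of_algebraicCount
    (hW16 : Wuthrich2014.thm16_halfEigenCharIdeal_dvd_cyclotomicPrime)
    (hGV : thm312_branch_unitContent_and_lambda_eq_residual_goodOrd)
    (hPal : Pal2012.thm32_sqrt_mul_realPeriodRat_twist_eq_of_prime_one_mod_four)
    (hmod : hasEntireLFunction_rat) (hmodD : nonempty_modularParametrizationData)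
    (hX : ClassX3Gord W p) (hp2 : p ≠ 2) (he : semistabilityIndex W p = 2)
    (S₀ : Finset (HeightOneSpectrum (𝓞 ℚ))) (hS₀ : ∀ v ∈ S₀, ((p : ℕ) : 𝓞 ℚ) ∉ v.asIdeal)
    (hS : ∀ v : HeightOneSpectrum (𝓞 ℚ), v ∉ S₀ → ((p : ℕ) : 𝓞 ℚ) ∉ v.asIdeal →
      W.HasGoodReductionAt v)
    (Φ₀ : AddSubgroup (W.geomTorsion (p : ℤ))) (hΦ : IsRationalLine W p Φ₀)
    (heven : LineEven W p Φ₀)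
    (hnt : ∃ (σ : absoluteGaloisGroup ℚ) (P : W.geomTorsion (p : ℤ)), P ∈ Φ₀ ∧ σ • P ≠ P)
    (hram : ∀ (K : Type) [Field K] [NumberField K] [(galRange (K := ℚ) K).Normal],
      Module.finrank ℚ K = 2 → (∃ θ : K, θ ^ 2 = algebraMap ℚ K ((-1) ^ (p / 2) * p)) →
      ¬ ∀ v : HeightOneSpectrum (𝓞 ℚ), ((p : ℕ) : 𝓞 ℚ) ∈ v.asIdeal →
        ∀ 𝔓 ∈ v.primesAbove, ∀ σ ∈ 𝔓.inertia (absoluteGaloisGroup ℚ), ∀ P ∈ Φ₀,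
          σ • P = (if σ ∈ galRange (K := ℚ) K then P else -P))
    (hAlg : ∀ (V : WeierstrassCurve ℚ) [V.IsElliptic] [V.IsGloballyMinimal],
      (∃ C : VariableChange ℚ, C • V.quadraticTwist ((-1) ^ (p / 2) * p : ℚ) = W) →
      ∀ (K : Type) [Field K] [NumberField K] [(galRange (K := ℚ) K).Normal]
      (F : Type) [Field F] [NumberField F] [IsCyclotomicExtension {p} ℚ F]
      [(galRange (K := ℚ) F).Normal]
      {κ : ZpExtension ℚ p} {γ : Field.absoluteGaloisGroup ℚ},
      p ≠ 2 → Module.finrank ℚ K = 2 →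
      (∃ θ : K, θ ^ 2 = algebraMap ℚ K ((-1) ^ (p / 2) * p)) →
      ¬ V.HasIrreducibleModPGaloisRep p →
      κ.IsCyclotomic → κ.IsTopGenerator γ → IsCyclotomicVariable p γ →
      γ ∈ galRange (K := ℚ) K → γ ∈ galRange (K := ℚ) F →
      ∀ (D : V.EigenSelmerDualData p
          (κ.kerSubgroup ⊓ galRange (K := ℚ) K ⊓ galRange (K := ℚ) F) κ.kerSubgroup
          (fun g ↦ if g ∈ galRange (K := ℚ) K then 1 else -1) γ)
        (g : IwasawaAlgebra p), D.charIdeal = Ideal.span {g} → HasUnitContent g →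
          p ^ (lam g + ∑ v ∈ S₀, delta W p v) =
            Nat.card (residualLineH1 W p κ S₀ Φ₀ hΦ) * Nat.card (residualQuotSelmer W p κ S₀ Φ₀ hΦ)) :
    CycLowerLeadingTermAt W p :=
  ClassX3Gord.cycLowerLeadingTermAt_of_forall_x3BranchMainConjecture hPal hmod hmodD hX hp2 he
    (ClassX3Gord.forall_x3BranchMainConjecture_of_thm312_of_algebraicCount hW16 hGV hX hp2 he S₀ hS₀ hS
      Φ₀ hΦ heven hnt hram hAlg)

/-- **X3♯(G-ord) ∩ `I₀*`, `p ≥ 5`, `r_an = 0`, `E` non-CM, OFF the anomalous rows: the N10 decl of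
record `Typed.MissingLowerBoundAt W p` (the LOWER half `ord_p #Ш_an ≤ ord_p #Ш`) from PRINT + the
displayed algebraic count.** PUBLISHED: `hW16` (Wuthrich Thm. 16), `hGV` (GV Thm. (3.12) on the
branch), `hPal` (Pal 2012), `hDel` (Delbourgo 2002 (A)+(B): control at the unstable prime,
`ℓ_p(E) = 1` off the anomalous rows), `hGZK`, `hmod`, `hmodD`. OPEN, displayed: `hAlg`
(Greenberg–Vatsal's algebraic `λ`-count on the branch, for every twist model). §1 into team n1011's
`ClassX3Gord.missingLowerBoundAt_rankZero_of_forall_x3BranchMainConjecture_of_nonAnomalous`. T-X3-χ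
of the seat memo with its ANALYTIC half discharged in the kernel. NOT a class theorem; nothing booked.
[cite: Delbourgo2002, Theorem (A), (B) (p. 40)] [cite: Pal2012, Thm. 3.2]
[cite: GreenbergVatsal2000, p. 4, §2 (16), §3 Thm. (3.12) p. 45] [cite: Wuthrich2014, Thm. 16 (p. 397)]
[cite: Miller2011LMS, Def. 1.1] -/
theorem ClassX3Gord.missingLowerBoundAt_rankZero_of_thm312_of_algebraicCount_of_nonAnomalous
    (hW16 : Wuthrich2014.thm16_halfEigenCharIdeal_dvd_cyclotomicPrime)
    (hGV : thm312_branch_unitContent_and_lambda_eq_residual_goodOrd)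
    (hPal : Pal2012.thm32_sqrt_mul_realPeriodRat_twist_eq_of_prime_one_mod_four)
    (hDel : Delbourgo2002.mainTheorem)
    (hGZK : rank_eq_analyticRank_of_analyticRank_le_one) (hmod : hasEntireLFunction_rat)
    (hmodD : nonempty_modularParametrizationData)
    (hX : ClassX3Gord W p) (hcm : ¬ W.HasCM) (hp5 : 5 ≤ p) (he : semistabilityIndex W p = 2)
    (hr : W.analyticRank = 0) (hna : Delbourgo2002.ReductionNonAnomalous W p)
    (S₀ : Finset (HeightOneSpectrum (𝓞 ℚ))) (hS₀ : ∀ v ∈ S₀, ((p : ℕ) : 𝓞 ℚ) ∉ v.asIdeal)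
    (hS : ∀ v : HeightOneSpectrum (𝓞 ℚ), v ∉ S₀ → ((p : ℕ) : 𝓞 ℚ) ∉ v.asIdeal →
      W.HasGoodReductionAt v)
    (Φ₀ : AddSubgroup (W.geomTorsion (p : ℤ))) (hΦ : IsRationalLine W p Φ₀)
    (heven : LineEven W p Φ₀)
    (hnt : ∃ (σ : absoluteGaloisGroup ℚ) (P : W.geomTorsion (p : ℤ)), P ∈ Φ₀ ∧ σ • P ≠ P)
    (hram : ∀ (K : Type) [Field K] [NumberField K] [(galRange (K := ℚ) K).Normal],
      Module.finrank ℚ K = 2 → (∃ θ : K, θ ^ 2 = algebraMap ℚ K ((-1) ^ (p / 2) * p)) →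
      ¬ ∀ v : HeightOneSpectrum (𝓞 ℚ), ((p : ℕ) : 𝓞 ℚ) ∈ v.asIdeal →
        ∀ 𝔓 ∈ v.primesAbove, ∀ σ ∈ 𝔓.inertia (absoluteGaloisGroup ℚ), ∀ P ∈ Φ₀,
          σ • P = (if σ ∈ galRange (K := ℚ) K then P else -P))
    (hAlg : ∀ (V : WeierstrassCurve ℚ) [V.IsElliptic] [V.IsGloballyMinimal],
      (∃ C : VariableChange ℚ, C • V.quadraticTwist ((-1) ^ (p / 2) * p : ℚ) = W) →
      ∀ (K : Type) [Field K] [NumberField K] [(galRange (K := ℚ) K).Normal]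
      (F : Type) [Field F] [NumberField F] [IsCyclotomicExtension {p} ℚ F]
      [(galRange (K := ℚ) F).Normal]
      {κ : ZpExtension ℚ p} {γ : Field.absoluteGaloisGroup ℚ},
      p ≠ 2 → Module.finrank ℚ K = 2 →
      (∃ θ : K, θ ^ 2 = algebraMap ℚ K ((-1) ^ (p / 2) * p)) →
      ¬ V.HasIrreducibleModPGaloisRep p →
      κ.IsCyclotomic → κ.IsTopGenerator γ → IsCyclotomicVariable p γ →
      γ ∈ galRange (K := ℚ) K → γ ∈ galRange (K := ℚ) F →
      ∀ (D : V.EigenSelmerDualData p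
          (κ.kerSubgroup ⊓ galRange (K := ℚ) K ⊓ galRange (K := ℚ) F) κ.kerSubgroup
          (fun g ↦ if g ∈ galRange (K := ℚ) K then 1 else -1) γ)
        (g : IwasawaAlgebra p), D.charIdeal = Ideal.span {g} → HasUnitContent g →
          p ^ (lam g + ∑ v ∈ S₀, delta W p v) =
            Nat.card (residualLineH1 W p κ S₀ Φ₀ hΦ) * Nat.card (residualQuotSelmer W p κ S₀ Φ₀ hΦ)) :
    MissingLowerBoundAt W p :=
  ClassX3Gord.missingLowerBoundAt_rankZero_of_forall_x3BranchMainConjecture_of_nonAnomalous hPal hDel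
    hGZK hmod hmodD hX hcm hp5 he hr hna
    (ClassX3Gord.forall_x3BranchMainConjecture_of_thm312_of_algebraicCount hW16 hGV hX (by omega) he S₀
      hS₀ hS Φ₀ hΦ heven hnt hram hAlg)

/-- **X3♯(G-ord) ∩ `I₀*`, `p ≥ 5`, `r_an = 0`, `E` non-CM, OFF the anomalous rows: Miller's
`BSD(E,p)` from PRINT + the displayed algebraic count.** The lower half as in the previous theorem;
the UPPER half is the Wuthrich component chain (team n1011 / additive-p2, over the ONE half-eigen
reading `hW16`) with Delbourgo 1998 Prop. 4 (`hDel98`) — no image, Tamagawa, Manin or `#Ш_an`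
hypothesis. PUBLISHED: `hW16 hGV hPal hDel98 hDel hGZK hmod hmodD`; OPEN, displayed: `hAlg`. §1 into
`ClassX3Gord.bsdp_rankZero_of_forall_x3BranchMainConjecture_of_nonAnomalous_of_thm16`. NOT a class
theorem; nothing booked. [cite: Delbourgo2002, Theorem (A), (B) (p. 40)] [cite: Delbourgo1998, Prop. 4 (p. 144)]
[cite: Wuthrich2014, Thm. 16 (p. 397), Cor. 18] [cite: GreenbergVatsal2000, p. 4, §2 (16), §3 Thm. (3.12) p. 45]
[cite: Pal2012, Thm. 3.2] [cite: Miller2011LMS, §1 and Def. 1.1] -/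
theorem ClassX3Gord.bsdp_rankZero_of_thm312_of_algebraicCount_of_nonAnomalous
    (hW16 : Wuthrich2014.thm16_halfEigenCharIdeal_dvd_cyclotomicPrime)
    (hGV : thm312_branch_unitContent_and_lambda_eq_residual_goodOrd)
    (hPal : Pal2012.thm32_sqrt_mul_realPeriodRat_twist_eq_of_prime_one_mod_four)
    (hDel98 : Delbourgo1998.prop4_rankZero_pow_dvd_constantCoeff) (hDel : Delbourgo2002.mainTheorem)
    (hGZK : rank_eq_analyticRank_of_analyticRank_le_one) (hmod : hasEntireLFunction_rat)
    (hmodD : nonempty_modularParametrizationData)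
    (hX : ClassX3Gord W p) (hcm : ¬ W.HasCM) (hp5 : 5 ≤ p) (he : semistabilityIndex W p = 2)
    (hr : W.analyticRank = 0) (hna : Delbourgo2002.ReductionNonAnomalous W p)
    (S₀ : Finset (HeightOneSpectrum (𝓞 ℚ))) (hS₀ : ∀ v ∈ S₀, ((p : ℕ) : 𝓞 ℚ) ∉ v.asIdeal)
    (hS : ∀ v : HeightOneSpectrum (𝓞 ℚ), v ∉ S₀ → ((p : ℕ) : 𝓞 ℚ) ∉ v.asIdeal →
      W.HasGoodReductionAt v)
    (Φ₀ : AddSubgroup (W.geomTorsion (p : ℤ))) (hΦ : IsRationalLine W p Φ₀)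
    (heven : LineEven W p Φ₀)
    (hnt : ∃ (σ : absoluteGaloisGroup ℚ) (P : W.geomTorsion (p : ℤ)), P ∈ Φ₀ ∧ σ • P ≠ P)
    (hram : ∀ (K : Type) [Field K] [NumberField K] [(galRange (K := ℚ) K).Normal],
      Module.finrank ℚ K = 2 → (∃ θ : K, θ ^ 2 = algebraMap ℚ K ((-1) ^ (p / 2) * p)) →
      ¬ ∀ v : HeightOneSpectrum (𝓞 ℚ), ((p : ℕ) : 𝓞 ℚ) ∈ v.asIdeal →
        ∀ 𝔓 ∈ v.primesAbove, ∀ σ ∈ 𝔓.inertia (absoluteGaloisGroup ℚ), ∀ P ∈ Φ₀,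
          σ • P = (if σ ∈ galRange (K := ℚ) K then P else -P))
    (hAlg : ∀ (V : WeierstrassCurve ℚ) [V.IsElliptic] [V.IsGloballyMinimal],
      (∃ C : VariableChange ℚ, C • V.quadraticTwist ((-1) ^ (p / 2) * p : ℚ) = W) →
      ∀ (K : Type) [Field K] [NumberField K] [(galRange (K := ℚ) K).Normal]
      (F : Type) [Field F] [NumberField F] [IsCyclotomicExtension {p} ℚ F]
      [(galRange (K := ℚ) F).Normal]
      {κ : ZpExtension ℚ p} {γ : Field.absoluteGaloisGroup ℚ},
      p ≠ 2 → Module.finrank ℚ K = 2 →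
      (∃ θ : K, θ ^ 2 = algebraMap ℚ K ((-1) ^ (p / 2) * p)) →
      ¬ V.HasIrreducibleModPGaloisRep p →
      κ.IsCyclotomic → κ.IsTopGenerator γ → IsCyclotomicVariable p γ →
      γ ∈ galRange (K := ℚ) K → γ ∈ galRange (K := ℚ) F →
      ∀ (D : V.EigenSelmerDualData p
          (κ.kerSubgroup ⊓ galRange (K := ℚ) K ⊓ galRange (K := ℚ) F) κ.kerSubgroup
          (fun g ↦ if g ∈ galRange (K := ℚ) K then 1 else -1) γ)
        (g : IwasawaAlgebra p), D.charIdeal = Ideal.span {g} → HasUnitContent g →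
          p ^ (lam g + ∑ v ∈ S₀, delta W p v) =
            Nat.card (residualLineH1 W p κ S₀ Φ₀ hΦ) * Nat.card (residualQuotSelmer W p κ S₀ Φ₀ hΦ)) :
    BSDp W p :=
  ClassX3Gord.bsdp_rankZero_of_forall_x3BranchMainConjecture_of_nonAnomalous_of_thm16 hW16 hPal hDel98
    hDel hGZK hmod hmodD hX hcm hp5 he hr hna
    (ClassX3Gord.forall_x3BranchMainConjecture_of_thm312_of_algebraicCount hW16 hGV hX (by omega) he S₀
      hS₀ hS Φ₀ hΦ heven hnt hram hAlg)

end EndState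

section BareLambda

variable {V : WeierstrassCurve ℚ} [V.IsElliptic] [V.IsGloballyMinimal]
  {W : WeierstrassCurve ℚ} [W.IsElliptic] [W.IsGloballyMinimal] {p : ℕ} [hp : Fact p.Prime]

/-- **The same composition over cell `bsd-eis` seat x3's bare-`λ` typing of the algebraic half**
(`X3Branch.X3BranchAlgebraicLambdaAt V p n`: every generator of every `char X_m` has unit content and
`λ = n`) together with the numeric identity `p^{n + Σ_{ℓ∈Σ₀} δ_E^{(ℓ)}} = #H¹(ℚ_Σ/ℚ_∞, Φ₀)·#U` for
every cyclotomic `κ` (the value GV's count predicts: x3's "`n = 2λ(L_p(φ_E,·)) + Σ s_ℓ t_ℓ(E)`" read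
through (9)/(16)). Wuthrich Thm. 16 ∧ GV Thm. (3.12)-branch ∧ these ⟹ `X3BranchMainConjectureAt V p`.
[cite: GreenbergVatsal2000, p. 4, §2 (16) p. 29 and p. 30, §3 Thm. (3.12) p. 45] [cite: Wuthrich2014, Thm. 16 (p. 397)] -/
theorem X3Branch.mainConjectureAt_of_thm312_of_algebraicLambda
    (hW16 : Wuthrich2014.thm16_halfEigenCharIdeal_dvd_cyclotomicPrime)
    (hGV : thm312_branch_unitContent_and_lambda_eq_residual_goodOrd)
    (hgood : GoodOrd V p)
    (htw : ∃ C : VariableChange ℚ, C • V.quadraticTwist ((-1) ^ (p / 2) * p : ℚ) = W)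
    (S₀ : Finset (HeightOneSpectrum (𝓞 ℚ))) (hS₀ : ∀ v ∈ S₀, ((p : ℕ) : 𝓞 ℚ) ∉ v.asIdeal)
    (hS : ∀ v : HeightOneSpectrum (𝓞 ℚ), v ∉ S₀ → ((p : ℕ) : 𝓞 ℚ) ∉ v.asIdeal →
      W.HasGoodReductionAt v)
    (Φ₀ : AddSubgroup (W.geomTorsion (p : ℤ))) (hΦ : IsRationalLine W p Φ₀)
    (heven : LineEven W p Φ₀)
    (hnt : ∃ (σ : absoluteGaloisGroup ℚ) (P : W.geomTorsion (p : ℤ)), P ∈ Φ₀ ∧ σ • P ≠ P)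
    (hram : ∀ (K : Type) [Field K] [NumberField K] [(galRange (K := ℚ) K).Normal],
      Module.finrank ℚ K = 2 → (∃ θ : K, θ ^ 2 = algebraMap ℚ K ((-1) ^ (p / 2) * p)) →
      ¬ ∀ v : HeightOneSpectrum (𝓞 ℚ), ((p : ℕ) : 𝓞 ℚ) ∈ v.asIdeal →
        ∀ 𝔓 ∈ v.primesAbove, ∀ σ ∈ 𝔓.inertia (absoluteGaloisGroup ℚ), ∀ P ∈ Φ₀,
          σ • P = (if σ ∈ galRange (K := ℚ) K then P else -P))
    {n : ℕ} (hBn : X3BranchAlgebraicLambdaAt V p n)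
    (hn : ∀ κ : ZpExtension ℚ p, κ.IsCyclotomic →
      p ^ (n + ∑ v ∈ S₀, delta W p v) =
        Nat.card (residualLineH1 W p κ S₀ Φ₀ hΦ) * Nat.card (residualQuotSelmer W p κ S₀ Φ₀ hΦ)) :
    X3BranchMainConjectureAt V p :=
  X3Branch.mainConjectureAt_of_thm312_of_algebraicCount hW16 hGV hgood htw S₀ hS₀ hS Φ₀ hΦ heven hnt
    hram fun K _ _ _ F _ _ _ _ κ γ hp2 h2 hθ hirr hκ hγ hcyc hγK hγF D g hchar _ ↦ by
      rw [(hBn K F hp2 h2 hθ hirr hκ hγ hcyc hγK hγF D g hchar).2]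
      exact hn κ hκ

end BareLambda

end Summit.BirchSwinnertonDyer.Rank1Residual.Additive

end
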